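import Mathlib
import HarnessLib
import Summits.HubbardSuperconductivity.HubbardSuperconductivity.Theorems.KLProgrammeC4aDirectSheetExclusion
import Summits.HubbardSuperconductivity.HubbardSuperconductivity.Theorems.KLProgrammeC4aTwoArcs

/-!
# Route `KLProgramme` — crux C4a, (U1) «(T)-MARGIN-PERTURBATIVE» part 2b: the direct-sheet exclusion row in ZONE form (for the arc-level margin-free theorems
# `arc_integral_le_mf`, `genericArc_integral_le_mf`, `genericArc_integral_le_unif_mf`, `genericArc_integral_ppFamily_le_mf`, `…SplitC…_mf`)

Cell `gate-hubbard-kl`, seat hubbard-kl-k3c3-p3 (g35; row «implicit-function / monotonicity route for μ(n)»).  Helper for stub (C) `stub_twoLeg_curvature` of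
`KLRegimeEngineV17F2` (stmt-HubbardSuperconductivity-20437); pen (R383) «(T)-MARGIN-A»; memo HOME/hubbard-kl-k3c3-p3/U1-CAUSTIC-SUP.md §18.

The margin-free arc theorems up to part 7 carry the row in zone form, `hT0 : ∀ ϑ ∈ [α₀, α₀ + Nℓ], ∀ χ, τ₀ < ‖S(ϑ) − 2Φ(0,χ)‖`; `…C4aDirectSheetExclusion` discharges the
`‖ϑ‖_𝕋`-form.  On a zone placed inside `[ϑ_T, 2π − ϑ_T]` the two agree (`…C4aTwoArcs.le_torusDist_of_mem_Icc`):
* **`directSheet_excluded_on_zone_of_margin`** (parent margin `6π²(2A + |ρ| + K_cτ₀/2)/(−μ−A−|ρ|) < ((2u_min/π)ϑ_T)²`, no extra door);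
* **`directSheet_excluded_on_zone_of_margin_perturbative`** (margin `10³(|ρ|/2 + 5ρ²/2 + K_cτ₀/2) < ((2u_min/π)ϑ_T)²`, door `A ≤ 1/200`).
Plumbing only; nothing asserts (C), K3, the window or superconductivity.
References: FST II CPAM 51 (1998) §3 [cite: FeldmanSalmhoferTrubowitz1998]; BGM 2006 §2.4 [cite: BenfattoGiulianiMastropietro2006].
-/

noncomputable section

namespace Summit.HubbardSuperconductivity.HubbardSuperconductivity.Theorems.C4a

set_option linter.dupNamespace false -- summit = problem name (single-conjunct summit), D-0017

open Real Set
open Literature.MathematicalPhysics.QuantumLattice Literature.MathematicalPhysics.QuantumLattice.BandSectorCounting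
open Literature.MathematicalPhysics.QuantumLattice.FermiRG
open Summit.HubbardSuperconductivity.HubbardSuperconductivity.Theorems.KLRegimeSplit
open Summit.HubbardSuperconductivity.HubbardSuperconductivity.Theorems.DispersionFlow
open Summit.HubbardSuperconductivity.HubbardSuperconductivity.Theorems.PerturbedFermiCurve

section Sizes

variable {K : TrigPolyC4v} {A : ℝ} (hA : ∀ p : Momentum, ∀ j ≤ 2, ‖iteratedFDeriv ℝ j (frameShift K) p‖ ≤ A)
  {μ r : ℝ} (hr : 0 < r) (hlo : (-1.1 : ℝ) < μ - r - A) (hhi : μ + r + A < -0.1)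
include hA hr hlo hhi

/-- **Direct-sheet exclusion on a zone placed off the tangency margin — ADDITIVE-SLACK margin** (no extra door): `0 ≤ ϑ_T ≤ α₀`, `α₀ + Nℓ ≤ 2π − ϑ_T`,
`6π²(2A + |ρ| + K_cτ₀/2)/(−μ−A−|ρ|) < ((2u_min/π)ϑ_T)²` ⟹ `∀ ϑ ∈ [α₀, α₀ + Nℓ], ∀ χ, τ₀ < ‖S_{ρ,ϑ,θ} − 2Φ(0,χ)‖` (the zone-form row `hT0` of the `…_mf` arc theorems). -/
theorem directSheet_excluded_on_zone_of_margin {Kc r₀ g₀ w : ℝ} (hG : GeomConstants (frameLevel μ K) Kc r₀ g₀ w) {ρ : ℝ} (hρ : |ρ| < r) (θ : ℝ)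
    {τ₀ ϑT α₀ ℓ : ℝ} {Nt : ℕ} (hϑT0 : 0 ≤ ϑT) (hT1 : ϑT ≤ α₀) (hT2 : α₀ + Nt * ℓ ≤ 2 * π - ϑT)
    (hϑT : 6 * π ^ 2 * (2 * A + |ρ| + Kc * τ₀ / 2) / (-μ - A - |ρ|) <
      (2 * (bandBounds (show (-4 : ℝ) < -1.1 by norm_num) (show (-1.1 : ℝ) ≤ -0.1 by norm_num) (show (-0.1 : ℝ) < 0 by norm_num)).umin / π * ϑT) ^ 2) :
    ∀ ϑ ∈ Icc α₀ (α₀ + Nt * ℓ), ∀ χ : ℝ, τ₀ < ‖pairSumPath μ K ρ ϑ θ 0 - (2 : ℝ) • levelPoint μ K 0 χ‖ :=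
  fun ϑ hϑ χ => directSheet_excluded_of_margin hA hr hlo hhi hG hρ θ hϑT0 hϑT ϑ (le_torusDist_of_mem_Icc hϑT0 ⟨hT1.trans hϑ.1, hϑ.2.trans hT2⟩) χ

/-- **Direct-sheet exclusion on a zone placed off the tangency margin — PERTURBATIVE margin** (flat door `A ≤ 1/200`; threshold-small): `0 ≤ ϑ_T ≤ α₀`,
`α₀ + Nℓ ≤ 2π − ϑ_T`, `10³(|ρ|/2 + 5ρ²/2 + K_cτ₀/2) < ((2u_min/π)ϑ_T)²` ⟹ `∀ ϑ ∈ [α₀, α₀ + Nℓ], ∀ χ, τ₀ < ‖S_{ρ,ϑ,θ} − 2Φ(0,χ)‖`. -/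
theorem directSheet_excluded_on_zone_of_margin_perturbative (hA200 : A ≤ 1 / 200) {Kc r₀ g₀ w : ℝ} (hG : GeomConstants (frameLevel μ K) Kc r₀ g₀ w)
    {ρ : ℝ} (hρ : |ρ| < r) (θ : ℝ) {τ₀ ϑT α₀ ℓ : ℝ} {Nt : ℕ} (hϑT0 : 0 ≤ ϑT) (hT1 : ϑT ≤ α₀) (hT2 : α₀ + Nt * ℓ ≤ 2 * π - ϑT)
    (hϑT : 1000 * (|ρ| / 2 + 5 / 2 * ρ ^ 2 + Kc * τ₀ / 2) <
      (2 * (bandBounds (show (-4 : ℝ) < -1.1 by norm_num) (show (-1.1 : ℝ) ≤ -0.1 by norm_num) (show (-0.1 : ℝ) < 0 by norm_num)).umin / π * ϑT) ^ 2) :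
    ∀ ϑ ∈ Icc α₀ (α₀ + Nt * ℓ), ∀ χ : ℝ, τ₀ < ‖pairSumPath μ K ρ ϑ θ 0 - (2 : ℝ) • levelPoint μ K 0 χ‖ :=
  fun ϑ hϑ χ => directSheet_excluded_of_margin_perturbative hA hr hlo hhi hA200 hG hρ θ hϑT0 hϑT ϑ
    (le_torusDist_of_mem_Icc hϑT0 ⟨hT1.trans hϑ.1, hϑ.2.trans hT2⟩) χ

end Sizes

end Summit.HubbardSuperconductivity.HubbardSuperconductivity.Theorems.C4a

end
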